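import Literature.NumberTheory.EllipticCurves.KatoDivisibilitySkeletonProofs
import HarnessLib

/-!
# Kato 2004, §17.13 (p. 280) and p. 274: "the main conjecture 12.10 implies the main conjecture
# 17.6" — the EQUALITY half of the §17.13 bookkeeping, proved as module theory

K. Kato, *`p`-adic Hodge theory and values of zeta functions of modular forms*, Astérisque **295**
(2004) 117–290 [Kato2004Asterisque]. The tree's `KatoDivisibilitySkeletonProofs` proves the
INEQUALITY half of §17.13 ("Thm. 17.4 becomes a consequence of Thm. 12.5"): from the four
cohomological inputs, taken as hypotheses on abstract `Λ`-modules `H` (`= 𝐇¹(T(k))`),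
`P` (`= 𝐇¹_loc(T(k))/𝐇¹_loc(T'(k))`), `X` (`= 𝔛(T*(1-k))`), `H2` (`= 𝐇²(T(k))`), the length
inequality `length H2_𝔭 ≤ length (H/Z)_𝔭` of Thm. 12.5 (3)/(4) gives
`length X_𝔭 ≤ ord_𝔭(L_{p-adic})`. This companion proves the EQUALITY half, printed twice:

* p. 274 (after Conj. 17.6): "As we will see in 17.13, the main conjecture 12.10 implies the main
  conjecture 17.6. The arguments to do this are similar to the arguments in deducing the classical
  Iwasawa main conjecture for the `p`-adic Riemann zeta function from the Iwasawa main conjecture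
  of the form 12.9, and are well known to experts."
* p. 280 (end of §17.13): "Let `𝔭` be a prime ideal of `Λ` of height one. In the case `𝔭` contains
  `p`, we assume `p ≠ 2` and that the condition (12.5.2) in 12.5 (4) is satisfied. By
  (17.13.2)–(17.13.4), we obtain from (17.13.1) an exact sequence
  `0 → 𝐇¹(T(k))_𝔭 → 𝐇¹_loc(T(k))_𝔭/𝐇¹_loc(T'(k))_𝔭 → 𝔛(T*(1-k))_𝔭 → 𝐇²(T(k))_𝔭 → 0`.
  Let `ω` … and `γ` … be good for `T` … By 17.11 and by 12.5, 16.6, we have an isomorphism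
  `𝐇¹_loc(T(k))_𝔭/𝐇¹_loc(T'(k))_𝔭 ≅ Λ_𝔭` which sends the image of `Z(f,T)(k)_𝔭` (12.5 (4)) onto
  `Λ_𝔭 · L_{p-adic,α,ω,γ}(f)`. Hence we obtain an exact sequence
  `0 → 𝐇¹(T(k))_𝔭/Z(f,T)(k)_𝔭 → Λ_𝔭/(L_{p-adic,α,ω,γ}(f)) → 𝔛(T*(1-k))_𝔭 → 𝐇²(T(k))_𝔭 → 0`.
  Hence `𝔛(T*(1-k))_𝔭` is a torsion `Λ_𝔭`-module, and
  `length_{Λ_𝔭}(𝔛(T*(1-k))_𝔭) − length_{Λ_𝔭}(Λ_𝔭/(L_{p-adic,α,ω,γ}))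
   = length_{Λ_𝔭}(𝐇²(T(k))_𝔭) − length_{Λ_𝔭}(𝐇¹(T(k))_𝔭/Z(f,T)(k)_𝔭)`.
  Hence Thm. 17.4 (resp. Conj. 17.6) becomes a consequence of Thm. 12.5 (resp. Conj. 12.10)."

with Conj. 12.10 (p. 224): "Let `T` be a `Gal(ℚ̄/ℚ)`-stable `O_λ`-lattice of `V_{F_λ}(f)` and let
`𝔭` be a prime ideal of `Λ` of height one. In the case `p = 2`, assume `𝔭` does not contain `2`.
Then `Z(f,T)_𝔭 ⊂ 𝐇¹(T)_𝔭` and `length_{Λ_𝔭}(𝐇²(T)_𝔭) = length_{Λ_𝔭}(𝐇¹(T)_𝔭/Z(f,T)_𝔭)`", and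
Conj. 17.6 (p. 274): "`length_{Λ_𝔭}(𝔛(T)_𝔭) = ord_𝔭(L_{p-adic,α,ω,γ}(f))` for any prime ideal `𝔭`
of height one of `Λ` which does not contain `p`. If furthermore `p ≠ 2` and if `ω` and `γ` are
good … then [the same] for any prime ideal `𝔭` of height one."

## What is proved (theorems only; no definition, no named fact — D-0014/D-0026)

The three inputs that upgrade the inequality to Kato's length IDENTITY are exactly the three
finiteness statements of the quotation: Prop. 17.11 (the Coleman map `col : P ↪ Λ` has FINITE
cokernel, so `(Λ/col P)_𝔭 = 0`), (17.13.4) (`𝐇²_loc(T(k))` is finite, "by the latter half of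
Thm. 12.5 (3)", so the fifth term of (17.13.1) dies at `𝔭`), and Thm. 16.6 with 17.11 (the image of
`Z(f,T)(k)_𝔭` is EXACTLY `Λ_𝔭 · L_{p-adic}` — not merely contains it). They enter below as the
vanishing / equality of the corresponding LOCAL LENGTHS at `𝔭` (`Module.lengthAt`, `ℕ∞`-valued), so
that nothing is assumed about the objects themselves:

* `Kato2004.lengthAt_skeleton_identity` — for `H →loc P →toX X →δ H2 →ε H2loc` exact at `P`, `X`,
  `H2` ((17.13.1) with (17.13.2): `loc` injective), `col : P ↪ R` and `Z ≤ H`, the unconditional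
  identity in `ℕ∞`, at every prime `𝔭` of any commutative ring `R`:
  `ℓ(X) + ℓ(H/Z) + ℓ(R/col P) + ℓ(ε H2) = ℓ(R/col(loc Z)) + ℓ(H2)`.
* `Kato2004.lengthAt_add_eq_of_skeleton` — with the three inputs at `𝔭`:
  `ℓ(X)_𝔭 + ℓ(H/Z)_𝔭 = ℓ(R/(G))_𝔭 + ℓ(H2)_𝔭` (Kato's displayed identity, written additively).
* `Kato2004.lengthAt_eq_of_conj12_10_of_skeleton` — **Conj. 12.10 at `𝔭` ⟹ Conj. 17.6 at `𝔭`**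
  (`ℓ(H2)_𝔭 = ℓ(H/Z)_𝔭 < ∞ ⟹ ℓ(X)_𝔭 = ℓ(R/(G))_𝔭 = ord_𝔭 G`), as printed; and the converse
  `Kato2004.lengthAt_eq_of_conj17_6_of_skeleton` (same exact sequence; Kato prints only "⟹").
* `Kato2004.isTorsionBy_quotient_of_skeleton` (`G · H ⊆ Z`) and private finiteness helpers
  (`ℓ(H/Z)_𝔭 < ∞`, `ℓ(R/(G))_𝔭 < ∞` at primes of height `≤ 1` of a Noetherian domain), so that
  over Kato's `Λ` the two conjectures are EQUIVALENT prime by prime: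
  `Kato2004.conj12_10_iff_conj17_6_of_skeleton`.
* `Module.charIdeal_eq_of_lengthAt_eq`, `Module.charIdeal_eq_span_of_lengthAt_eq_quotient` (generic:
  over a Noetherian UFD, `ℓ_𝔭(M) = ℓ_𝔭(R/(G))` at all height-one `𝔭` ⟹ `char(M) = (G)`), and
  `Kato2004.charIdeal_eq_span_of_conj12_10_of_skeleton` — the characteristic-IDEAL form over a
  Noetherian UFD (e.g. `Λ = ℤ_p⟦T⟧`): Conj. 12.10 at every height-one prime ⟹ `X` torsion and
  `char_R X = (G)`.
* `Kato2004.charIdeal_eq_span_padicLFunction_of_conj12_10_of_skeleton` — for `E/ℚ`, `p` good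
  ordinary, `D : W.SelmerDualData κ γ` and `ι G = L_p(E,T)` (Thm. 17.4 (3): `L_{p-adic} ∈ Λ` under
  `p ≠ 2` + (12.5.2)): Conj. 12.10 (abstract, at every height-one `𝔭`) ⟹ `D.X` torsion and
  `D.charIdeal = (g)` with `ι g = L_p(E,T)` — literally the conclusion of clause 3 of the tree's
  named fact `skinner_urban_main_conjecture` (Skinner–Urban 2014 Thm. 3.6.9 = Conj. 17.6 for
  `T_pE`), i.e. the Mazur main conjecture in the tree's currency.

So a main conjecture typed in KATO's shape (12.10: zeta elements versus `𝐇²`; the shape the cell's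
O5/O6 interfaces call `KMC`, definition request D-O6-2) and one typed in MAZUR's shape (17.6 /
`skinner_urban_main_conjecture` (3) / `MazurMainConjecture`) are interchangeable by kernel theorems
modulo the three printed finiteness inputs, at good ordinary `p`. Nothing here defines `𝐇^q(T)`,
`Z(f,T)` or the Coleman map, and nothing is asserted about them.

References: [Kato2004Asterisque] Conj. 12.10 (p. 224), Thm. 12.5 (pp. 221–222), Prop. 17.11
(p. 277), Conj. 17.6 (p. 274), §17.13 (pp. 279–280); the inequality half and the hypotheses'
provenance: `KatoDivisibilitySkeletonProofs` (this tree). Local lengths / characteristic ideals: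
Bourbaki AC VII §4.4–4.5; [Washington1997] §13.2.
-/

noncomputable section

open scoped MatrixGroups ModularForm

open CongruenceSubgroup Literature.NumberTheory.EllipticCurves.ModularForms

namespace Literature.NumberTheory.EllipticCurves

open Module

/-! ### Generic: characteristic ideals are determined by height-one local lengths -/

namespace Module

variable {R : Type*} [CommRing R] {M N : Type*} [AddCommGroup M] [_root_.Module R M]
  [AddCommGroup N] [_root_.Module R N]

/-- Two modules with the same local lengths at every height-one prime have the same characteristic
ideal (immediate from the definition `char(M) = ∏_{ht 𝔭 = 1} 𝔭^{ℓ_𝔭(M)}`, Washington §13.2 /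
Bourbaki AC VII §4.5). [cite: Washington1997, §13.2] -/
theorem charIdeal_eq_of_lengthAt_eq
    (h : ∀ 𝔭 : PrimeSpectrum R, 𝔭.asIdeal.height = 1 → lengthAt R M 𝔭 = lengthAt R N 𝔭) :
    charIdeal R M = charIdeal R N := by
  unfold charIdeal
  exact finprod_mem_congr rfl fun 𝔭 h𝔭 => by rw [h 𝔭 h𝔭]

open scoped Classical in
/-- **A module over a Noetherian UFD whose height-one local lengths are those of the non-zero cyclic
module `R/(L)` has characteristic ideal `(L)`** (`ℓ_𝔭(M) = ord_𝔭(L)` for all height-one `𝔭`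
⟹ `char(M) = (L)`): factor `L` into primes `π₁ ⋯ π_r`; the local length of `R/(π₁ ⋯ π_r)` at a
height-one prime `𝔭` is the number of `πᵢ ∈ 𝔭` (`lengthAt_quotient_span_singleton_multisetProd`,
`lengthAt_quotient_span_singleton`), and `∏_{ht 𝔭 = 1} 𝔭^{#{i | πᵢ ∈ 𝔭}} = (π₁ ⋯ π_r)`
(`finprod_heightOne_pow_eq_span_prod`); cf. the Summits-side `char(R/(L)) = (L)` of
`Summit.…X11b.CongruenceLimit.charIdeal_quotient_span_singleton`. [cite: Washington1997, §13.2] -/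
theorem charIdeal_eq_span_of_lengthAt_eq_quotient [IsNoetherianRing R] [IsDomain R]
    [UniqueFactorizationMonoid R] {L : R} (hL : L ≠ 0)
    (h : ∀ 𝔭 : PrimeSpectrum R, 𝔭.asIdeal.height = 1 →
      lengthAt R M 𝔭 = lengthAt R (R ⧸ Ideal.span {L}) 𝔭) :
    charIdeal R M = Ideal.span {L} := by
  classical
  set s : Multiset R := UniqueFactorizationMonoid.factors L with hs
  have hprime : ∀ π ∈ s, Prime π := fun π hπ => UniqueFactorizationMonoid.prime_of_factor π hπ
  have hassoc : Associated s.prod L := UniqueFactorizationMonoid.factors_prod hL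
  have hspan : Ideal.span {L} = Ideal.span {s.prod} :=
    (Ideal.span_singleton_eq_span_singleton.mpr hassoc).symm
  have hlen : ∀ 𝔭 : PrimeSpectrum R, lengthAt R (R ⧸ Ideal.span {L}) 𝔭 =
      lengthAt R (R ⧸ Ideal.span {s.prod}) 𝔭 := fun 𝔭 =>
    lengthAt_eq_of_linearEquiv (Submodule.quotEquivOfEq _ _ hspan) 𝔭
  conv_rhs => rw [hspan, ← finprod_heightOne_pow_eq_span_prod s hprime]
  unfold charIdeal
  refine finprod_mem_congr rfl fun 𝔭 h𝔭 => ?_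
  have h1 : 𝔭.asIdeal.height = 1 := h𝔭
  congr 1
  rw [h 𝔭 h1, hlen 𝔭,
    lengthAt_quotient_span_singleton_multisetProd s (fun a ha => (hprime a ha).ne_zero) 𝔭]
  have hmap : (s.map fun a => lengthAt R (R ⧸ Ideal.span {a}) 𝔭) =
      (s.map fun π => ((if π ∈ 𝔭.asIdeal then 1 else 0 : ℕ) : ℕ∞)) := by
    refine Multiset.map_congr rfl fun π hπ => ?_
    rw [lengthAt_quotient_span_singleton (hprime π hπ) 𝔭 h1]
    split_ifs <;> simp
  have hcast : (s.map fun π => ((if π ∈ 𝔭.asIdeal then 1 else 0 : ℕ) : ℕ∞)) =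
      (s.map fun π => (if π ∈ 𝔭.asIdeal then 1 else 0 : ℕ)).map (fun n : ℕ => (n : ℕ∞)) := by
    rw [Multiset.map_map]; rfl
  rw [hmap, hcast, ← Nat.cast_multiset_sum, ENat.toNat_coe]

/-- `R/(G)` is killed by `G`. [folklore] -/
private theorem isTorsionBy_quotient_span_singleton (G : R) :
    Module.IsTorsionBy R (R ⧸ Ideal.span {G}) G := by
  intro q
  obtain ⟨y, rfl⟩ := Submodule.Quotient.mk_surjective _ q
  rw [← Submodule.Quotient.mk_smul, Submodule.Quotient.mk_eq_zero, smul_eq_mul]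
  exact Ideal.mul_mem_right y _ (Ideal.mem_span_singleton_self G)

end Module

namespace Kato2004

/-! ### §17.13, p. 280: the length identity over an arbitrary commutative ring -/

section Identity

variable {R : Type*} [CommRing R]
  {H P X H2 H2loc : Type*} [AddCommGroup H] [_root_.Module R H] [AddCommGroup P]
  [_root_.Module R P] [AddCommGroup X] [_root_.Module R X] [AddCommGroup H2] [_root_.Module R H2]
  [AddCommGroup H2loc] [_root_.Module R H2loc]

/-- For `M' →f M →g M''` exact at `M`: `ℓ(M)_𝔭 = ℓ(f M')_𝔭 + ℓ(g M)_𝔭`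
(`M / im f = M / ker g ≅ im g`). [folklore] -/
private theorem lengthAt_eq_range_add_range {M' M M'' : Type*} [AddCommGroup M']
    [_root_.Module R M'] [AddCommGroup M] [_root_.Module R M] [AddCommGroup M'']
    [_root_.Module R M'']
    (f : M' →ₗ[R] M) (g : M →ₗ[R] M'') (hfg : Function.Exact f g) (𝔭 : PrimeSpectrum R) :
    lengthAt R M 𝔭 = lengthAt R (LinearMap.range f) 𝔭 + lengthAt R (LinearMap.range g) 𝔭 := by
  rw [lengthAt_eq_add_quotient (LinearMap.range f) 𝔭, ← LinearMap.exact_iff.mp hfg,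
    lengthAt_eq_of_linearEquiv g.quotKerEquivRange 𝔭]

/-- `ℓ(P / loc Z)_𝔭 = ℓ(H/Z)_𝔭 + ℓ(P / loc H)_𝔭` for `loc : H ↪ P` injective and `Z ≤ H`
(`0 → H/Z → P/loc Z → P/loc H → 0`). [folklore] -/
private theorem lengthAt_quotient_map_eq (loc : H →ₗ[R] P) (hinj : Function.Injective loc)
    (Z : Submodule R H) (𝔭 : PrimeSpectrum R) :
    lengthAt R (P ⧸ Z.map loc) 𝔭 =
      lengthAt R (H ⧸ Z) 𝔭 + lengthAt R (P ⧸ LinearMap.range loc) 𝔭 := by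
  set LZ : Submodule R P := Z.map loc with hLZ
  have hLZle : LZ ≤ LinearMap.range loc := LinearMap.map_le_range
  set N : Submodule R (P ⧸ LZ) := Submodule.map LZ.mkQ (LinearMap.range loc) with hN
  have hQN : lengthAt R (P ⧸ LZ) 𝔭 = lengthAt R N 𝔭 + lengthAt R ((P ⧸ LZ) ⧸ N) 𝔭 :=
    lengthAt_eq_add_quotient N 𝔭
  have hthird : lengthAt R ((P ⧸ LZ) ⧸ N) 𝔭 = lengthAt R (P ⧸ LinearMap.range loc) 𝔭 :=
    lengthAt_eq_of_linearEquiv (Submodule.quotientQuotientEquivQuotient LZ _ hLZle) 𝔭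
  have hNeq : lengthAt R N 𝔭 = lengthAt R (H ⧸ Z) 𝔭 := by
    set g : H →ₗ[R] P ⧸ LZ := LZ.mkQ ∘ₗ loc with hg
    have hrange : LinearMap.range g = N := by rw [hg, LinearMap.range_comp, hN]
    have hker : LinearMap.ker g = Z := by
      rw [hg, LinearMap.ker_comp, Submodule.ker_mkQ, hLZ, Submodule.comap_map_eq_of_injective hinj]
    calc lengthAt R N 𝔭 = lengthAt R (LinearMap.range g) 𝔭 := by rw [hrange]
      _ = lengthAt R (H ⧸ LinearMap.ker g) 𝔭 :=
          (lengthAt_eq_of_linearEquiv g.quotKerEquivRange 𝔭).symm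
      _ = lengthAt R (H ⧸ Z) 𝔭 := by rw [hker]
  rw [hQN, hthird, hNeq]

/-- `ℓ(R / col(LZ))_𝔭 = ℓ(P / LZ)_𝔭 + ℓ(R / col P)_𝔭` for `col : P ↪ R` injective and `LZ ≤ P`
(`0 → P/LZ → R/col(LZ) → R/col(P) → 0`). [folklore] -/
private theorem lengthAt_quotient_ideal_map_eq (col : P →ₗ[R] R) (hcol : Function.Injective col)
    (LZ : Submodule R P) (𝔭 : PrimeSpectrum R) :
    lengthAt R (R ⧸ LZ.map col) 𝔭 =
      lengthAt R (P ⧸ LZ) 𝔭 + lengthAt R (R ⧸ LinearMap.range col) 𝔭 := by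
  set I : Ideal R := LZ.map col with hI
  have hIle : I ≤ LinearMap.range col := LinearMap.map_le_range
  have hle : LZ ≤ Submodule.comap col I := fun y hy => ⟨y, hy, rfl⟩
  -- `φ = Submodule.mapQ LZ I col hle : P/LZ ↪ R/I`, induced by `col`
  have hφinj : Function.Injective (Submodule.mapQ LZ I col hle) := by
    rw [← LinearMap.ker_eq_bot, Submodule.ker_mapQ, Submodule.comap_map_eq_of_injective hcol,
      Submodule.mkQ_map_self]
  have hφrange : LinearMap.range (Submodule.mapQ LZ I col hle) =
      Submodule.map I.mkQ (LinearMap.range col) := by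
    unfold Submodule.mapQ
    rw [Submodule.range_liftQ, LinearMap.range_comp]
  have h1 : lengthAt R (R ⧸ I) 𝔭 = lengthAt R (LinearMap.range (Submodule.mapQ LZ I col hle)) 𝔭 +
      lengthAt R ((R ⧸ I) ⧸ LinearMap.range (Submodule.mapQ LZ I col hle)) 𝔭 :=
    lengthAt_eq_add_quotient _ 𝔭
  have h2 : lengthAt R (LinearMap.range (Submodule.mapQ LZ I col hle)) 𝔭 = lengthAt R (P ⧸ LZ) 𝔭 :=
    (lengthAt_eq_of_linearEquiv (LinearEquiv.ofInjective _ hφinj) 𝔭).symm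
  have h3 : lengthAt R ((R ⧸ I) ⧸ LinearMap.range (Submodule.mapQ LZ I col hle)) 𝔭 =
      lengthAt R (R ⧸ LinearMap.range col) 𝔭 := by
    rw [hφrange]
    exact lengthAt_eq_of_linearEquiv (Submodule.quotientQuotientEquivQuotient I _ hIle) 𝔭
  rw [h1, h2, h3]

/-- **Kato §17.13 (p. 280), the length identity behind "17.4 ⟸ 12.5" AND "17.6 ⟸ 12.10", with no
finiteness input.** Let `H →loc P →toX X →δ H2 →ε H2loc` be `R`-linear, exact at `P`, `X` and `H2`
(the five-term Poitou–Tate sequence (17.13.1) with (17.13.3); `loc` injective = (17.13.2)), let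
`col : P → R` be injective (Prop. 17.11) and `Z ≤ H` (the zeta elements, 12.5 (4)). Then at every
prime `𝔭`, in `ℕ∞`:
`ℓ(X) + ℓ(H/Z) + ℓ(R/col P) + ℓ(ε H2) = ℓ(R/col(loc Z)) + ℓ(H2)`.
(Additivity of local length along `0 → H/Z → P/loc Z → P/loc H → 0`, `P/loc H ≅ im toX`,
`X/im toX ≅ im δ = ker ε`, `0 → P/loc Z → R/col(loc Z) → R/col P → 0`.)
[cite: Kato2004Asterisque, §17.13 (p. 280)] -/
theorem lengthAt_skeleton_identity (loc : H →ₗ[R] P) (hinj : Function.Injective loc)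
    (toX : P →ₗ[R] X) (δ : X →ₗ[R] H2) (ε : H2 →ₗ[R] H2loc)
    (hPX : Function.Exact loc toX) (hXH : Function.Exact toX δ) (hHE : Function.Exact δ ε)
    (col : P →ₗ[R] R) (hcol : Function.Injective col) (Z : Submodule R H)
    (𝔭 : PrimeSpectrum R) :
    lengthAt R X 𝔭 + lengthAt R (H ⧸ Z) 𝔭 + lengthAt R (R ⧸ LinearMap.range col) 𝔭 +
        lengthAt R (LinearMap.range ε) 𝔭 =
      lengthAt R (R ⧸ (Z.map loc).map col) 𝔭 + lengthAt R H2 𝔭 := by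
  have hX := lengthAt_eq_range_add_range toX δ hXH 𝔭
  have hH2 := lengthAt_eq_range_add_range δ ε hHE 𝔭
  have hC : lengthAt R (LinearMap.range toX) 𝔭 = lengthAt R (P ⧸ LinearMap.range loc) 𝔭 := by
    rw [← LinearMap.exact_iff.mp hPX]
    exact (lengthAt_eq_of_linearEquiv toX.quotKerEquivRange 𝔭).symm
  have hB := lengthAt_quotient_map_eq loc hinj Z 𝔭
  have hRI := lengthAt_quotient_ideal_map_eq col hcol (Z.map loc) 𝔭
  rw [hX, hH2, hC, hRI, hB]
  ring

/-- **Kato's displayed identity (p. 280), additively: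
`ℓ(X)_𝔭 + ℓ(H/Z)_𝔭 = ℓ(R/(G))_𝔭 + ℓ(H2)_𝔭`** — i.e.
"`length(𝔛_𝔭) − length(Λ_𝔭/(L_{p-adic})) = length(𝐇²_𝔭) − length(𝐇¹_𝔭/Z(f,T)_𝔭)`" — from
`lengthAt_skeleton_identity` and the three printed inputs AT `𝔭`: the Coleman map has finite
cokernel (Prop. 17.11: `ℓ(R/col P)_𝔭 = 0`), `𝐇²_loc(T(k))` is finite ((17.13.4):
`ℓ(H2loc)_𝔭 = 0`), and the image of `Z(f,T)(k)_𝔭` in `Λ_𝔭` is `Λ_𝔭 · L_{p-adic}` (Thm. 16.6 with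
17.11: `ℓ(R/col(loc Z))_𝔭 = ℓ(R/(G))_𝔭`, `G` playing `L_{p-adic,α,ω,γ}(f)`).
[cite: Kato2004Asterisque, §17.13 (p. 280), Prop. 17.11 (p. 277), Thm. 16.6 (p. 271)] -/
theorem lengthAt_add_eq_of_skeleton (loc : H →ₗ[R] P) (hinj : Function.Injective loc)
    (toX : P →ₗ[R] X) (δ : X →ₗ[R] H2) (ε : H2 →ₗ[R] H2loc)
    (hPX : Function.Exact loc toX) (hXH : Function.Exact toX δ) (hHE : Function.Exact δ ε)
    (col : P →ₗ[R] R) (hcol : Function.Injective col) (Z : Submodule R H) {G : R}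
    (𝔭 : PrimeSpectrum R) (hcoker : lengthAt R (R ⧸ LinearMap.range col) 𝔭 = 0)
    (hloc2 : lengthAt R H2loc 𝔭 = 0)
    (hIG : lengthAt R (R ⧸ (Z.map loc).map col) 𝔭 = lengthAt R (R ⧸ Ideal.span {G}) 𝔭) :
    lengthAt R X 𝔭 + lengthAt R (H ⧸ Z) 𝔭 =
      lengthAt R (R ⧸ Ideal.span {G}) 𝔭 + lengthAt R H2 𝔭 := by
  have h := lengthAt_skeleton_identity loc hinj toX δ ε hPX hXH hHE col hcol Z 𝔭
  have hε : lengthAt R (LinearMap.range ε) 𝔭 = 0 :=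
    nonpos_iff_eq_zero.mp (hloc2 ▸ lengthAt_submodule_le (LinearMap.range ε) 𝔭)
  rwa [hcoker, hε, add_zero, add_zero, hIG] at h

/-- **Kato, p. 274 / p. 280: "the main conjecture 12.10 implies the main conjecture 17.6", at one
height-one prime `𝔭`.** In the situation of `lengthAt_add_eq_of_skeleton`: if Conj. 12.10 holds at
`𝔭` — `length_{Λ_𝔭}(𝐇²(T)_𝔭) = length_{Λ_𝔭}(𝐇¹(T)_𝔭/Z(f,T)_𝔭)`, a finite number — then
Conj. 17.6 holds at `𝔭`: `length_{Λ_𝔭}(𝔛_𝔭) = length_{Λ_𝔭}(Λ_𝔭/(G)) = ord_𝔭(G)`.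
[cite: Kato2004Asterisque, Conj. 12.10 (p. 224), Conj. 17.6 (p. 274), §17.13 (p. 280)] -/
theorem lengthAt_eq_of_conj12_10_of_skeleton (loc : H →ₗ[R] P) (hinj : Function.Injective loc)
    (toX : P →ₗ[R] X) (δ : X →ₗ[R] H2) (ε : H2 →ₗ[R] H2loc)
    (hPX : Function.Exact loc toX) (hXH : Function.Exact toX δ) (hHE : Function.Exact δ ε)
    (col : P →ₗ[R] R) (hcol : Function.Injective col) (Z : Submodule R H) {G : R}
    (𝔭 : PrimeSpectrum R) (hcoker : lengthAt R (R ⧸ LinearMap.range col) 𝔭 = 0)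
    (hloc2 : lengthAt R H2loc 𝔭 = 0)
    (hIG : lengthAt R (R ⧸ (Z.map loc).map col) 𝔭 = lengthAt R (R ⧸ Ideal.span {G}) 𝔭)
    (hfin : lengthAt R (H ⧸ Z) 𝔭 ≠ ⊤) (hMC : lengthAt R H2 𝔭 = lengthAt R (H ⧸ Z) 𝔭) :
    lengthAt R X 𝔭 = lengthAt R (R ⧸ Ideal.span {G}) 𝔭 := by
  have h := lengthAt_add_eq_of_skeleton loc hinj toX δ ε hPX hXH hHE col hcol Z 𝔭 hcoker hloc2 hIG
  rw [hMC] at h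
  exact (add_left_inj_of_ne_top hfin).mp h

/-- **The converse at `𝔭`:** if `ℓ(X)_𝔭 = ℓ(R/(G))_𝔭` is finite then `ℓ(H2)_𝔭 = ℓ(H/Z)_𝔭`.
This is the other reading of Kato's PRINTED identity (p. 280) "`length_{Λ_𝔭}(𝔛_𝔭) −
length_{Λ_𝔭}(Λ_𝔭/(L_{p-adic})) = length_{Λ_𝔭}(𝐇²_𝔭) − length_{Λ_𝔭}(𝐇¹_𝔭/Z(f,T)_𝔭)`"; Kato draws
from it only "Conj. 17.6 becomes a consequence of Conj. 12.10" — the implication "17.6 at `𝔭` ⟹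
12.10 at `𝔭`" is the same identity and is recorded here for the cell's two-way bookkeeping.
[cite: Kato2004Asterisque, §17.13 (p. 280), the displayed length identity] -/
theorem lengthAt_eq_of_conj17_6_of_skeleton (loc : H →ₗ[R] P) (hinj : Function.Injective loc)
    (toX : P →ₗ[R] X) (δ : X →ₗ[R] H2) (ε : H2 →ₗ[R] H2loc)
    (hPX : Function.Exact loc toX) (hXH : Function.Exact toX δ) (hHE : Function.Exact δ ε)
    (col : P →ₗ[R] R) (hcol : Function.Injective col) (Z : Submodule R H) {G : R}
    (𝔭 : PrimeSpectrum R) (hcoker : lengthAt R (R ⧸ LinearMap.range col) 𝔭 = 0)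
    (hloc2 : lengthAt R H2loc 𝔭 = 0)
    (hIG : lengthAt R (R ⧸ (Z.map loc).map col) 𝔭 = lengthAt R (R ⧸ Ideal.span {G}) 𝔭)
    (hfin : lengthAt R (R ⧸ Ideal.span {G}) 𝔭 ≠ ⊤)
    (h176 : lengthAt R X 𝔭 = lengthAt R (R ⧸ Ideal.span {G}) 𝔭) :
    lengthAt R H2 𝔭 = lengthAt R (H ⧸ Z) 𝔭 := by
  have h := lengthAt_add_eq_of_skeleton loc hinj toX δ ε hPX hXH hHE col hcol Z 𝔭 hcoker hloc2 hIG
  rw [h176] at h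
  exact ((add_right_inj_of_ne_top hfin).mp h).symm

/-- `G · H ⊆ Z` when `col (loc z) = G` for some `z ∈ Z` and `col`, `loc` are injective: for `h ∈ H`,
`col (loc (G • h − col(loc h) • z)) = 0`. Hence `H/Z` is killed by `G`.
[cite: Kato2004Asterisque, §17.13 (p. 280)] -/
theorem isTorsionBy_quotient_of_skeleton (loc : H →ₗ[R] P) (hinj : Function.Injective loc)
    (col : P →ₗ[R] R) (hcol : Function.Injective col) (Z : Submodule R H) {G : R}
    (hGZ : G ∈ Submodule.map (col ∘ₗ loc) Z) : Module.IsTorsionBy R (H ⧸ Z) G := by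
  obtain ⟨z, hzZ, hz⟩ := Submodule.mem_map.mp hGZ
  simp only [LinearMap.coe_comp, Function.comp_apply] at hz
  intro q
  obtain ⟨h, rfl⟩ := Submodule.Quotient.mk_surjective _ q
  rw [← Submodule.Quotient.mk_smul, Submodule.Quotient.mk_eq_zero]
  have hmem : col (loc h) • z ∈ Z := Z.smul_mem _ hzZ
  have heq : G • h = col (loc h) • z := by
    apply hinj
    apply hcol
    simp only [map_smul, hz, smul_eq_mul, mul_comm]
  rw [heq]
  exact hmem

end Identity

/-! ### Over a Noetherian domain: finiteness of the lengths, and the prime-by-prime equivalence -/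

section Domain

variable {R : Type*} [CommRing R] [IsDomain R]
  {H P X H2 H2loc : Type*} [AddCommGroup H] [_root_.Module R H] [AddCommGroup P]
  [_root_.Module R P] [AddCommGroup X] [_root_.Module R X] [AddCommGroup H2] [_root_.Module R H2]
  [AddCommGroup H2loc] [_root_.Module R H2loc]

/-- Over a Noetherian domain, with `H` finitely generated: `ℓ(H/Z)_𝔭 < ∞` at every prime of height
`≤ 1` as soon as `0 ≠ G ∈ col(loc Z)` (`H/Z` is killed by `G`). [folklore] -/
private theorem lengthAt_quotient_ne_top_of_skeleton [IsNoetherianRing R] [Module.Finite R H]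
    (loc : H →ₗ[R] P) (hinj : Function.Injective loc)
    (col : P →ₗ[R] R) (hcol : Function.Injective col) (Z : Submodule R H) {G : R} (hG : G ≠ 0)
    (hGZ : G ∈ Submodule.map (col ∘ₗ loc) Z) (𝔭 : PrimeSpectrum R) (h𝔭 : 𝔭.asIdeal.height ≤ 1) :
    lengthAt R (H ⧸ Z) 𝔭 ≠ ⊤ :=
  lengthAt_ne_top_of_isTorsionBy hG (isTorsionBy_quotient_of_skeleton loc hinj col hcol Z hGZ) 𝔭 h𝔭

/-- Over a Noetherian domain: `ℓ(R/(G))_𝔭 = ord_𝔭(G) < ∞` at every prime of height `≤ 1` for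
`G ≠ 0`. [folklore] -/
private theorem lengthAt_quotient_span_singleton_ne_top [IsNoetherianRing R] {G : R} (hG : G ≠ 0)
    (𝔭 : PrimeSpectrum R) (h𝔭 : 𝔭.asIdeal.height ≤ 1) :
    lengthAt R (R ⧸ Ideal.span {G}) 𝔭 ≠ ⊤ :=
  lengthAt_ne_top_of_isTorsionBy hG (Module.isTorsionBy_quotient_span_singleton G) 𝔭 h𝔭

/-- **Conj. 12.10 at `𝔭` ⟺ Conj. 17.6 at `𝔭`, for every prime `𝔭` of height `≤ 1` of a
Noetherian domain (Kato's `Λ`), under Kato's §17.13 data.** Hypotheses: `H` torsion free of rank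
`≤ 1` and finitely generated (Thm. 12.4 (2)); `H →loc P →toX X →δ H2 →ε H2loc` exact at `P`, `X`,
`H2` ((17.13.1), (17.13.3)); `col : P ↪ R` (Prop. 17.11); `Z ≤ H` with `0 ≠ G ∈ col(loc Z)`
(Thm. 16.6); and AT `𝔭`: `ℓ(R/col P)_𝔭 = 0` (17.11, finite cokernel), `ℓ(H2loc)_𝔭 = 0`
((17.13.4)), `ℓ(R/col(loc Z))_𝔭 = ℓ(R/(G))_𝔭` (16.6: the image is exactly `Λ_𝔭·L_{p-adic}`).
Then `ℓ(H2)_𝔭 = ℓ(H/Z)_𝔭 ↔ ℓ(X)_𝔭 = ℓ(R/(G))_𝔭`. The direction "→" is Kato's printed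
"12.10 implies 17.6" (p. 274, p. 280); "←" is the same exact sequence read backwards.
[cite: Kato2004Asterisque, Conj. 12.10 (p. 224), Conj. 17.6 (p. 274), §17.13 (pp. 279–280)] -/
theorem conj12_10_iff_conj17_6_of_skeleton [IsNoetherianRing R] [Module.Finite R H]
    [Module.IsTorsionFree R H] (hrank : Module.rank R H ≤ 1)
    (loc : H →ₗ[R] P) (toX : P →ₗ[R] X) (δ : X →ₗ[R] H2) (ε : H2 →ₗ[R] H2loc)
    (hPX : Function.Exact loc toX) (hXH : Function.Exact toX δ) (hHE : Function.Exact δ ε)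
    (col : P →ₗ[R] R) (hcol : Function.Injective col) (Z : Submodule R H) {G : R} (hG : G ≠ 0)
    (hGZ : G ∈ Submodule.map (col ∘ₗ loc) Z)
    (𝔭 : PrimeSpectrum R) (h𝔭 : 𝔭.asIdeal.height ≤ 1)
    (hcoker : lengthAt R (R ⧸ LinearMap.range col) 𝔭 = 0) (hloc2 : lengthAt R H2loc 𝔭 = 0)
    (hIG : lengthAt R (R ⧸ (Z.map loc).map col) 𝔭 = lengthAt R (R ⧸ Ideal.span {G}) 𝔭) :
    lengthAt R H2 𝔭 = lengthAt R (H ⧸ Z) 𝔭 ↔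
      lengthAt R X 𝔭 = lengthAt R (R ⧸ Ideal.span {G}) 𝔭 := by
  obtain ⟨z, -, hz⟩ := Submodule.mem_map.mp hGZ
  simp only [LinearMap.coe_comp, Function.comp_apply] at hz
  have hinj : Function.Injective loc := loc_injective hrank loc col hG hz
  constructor
  · exact lengthAt_eq_of_conj12_10_of_skeleton loc hinj toX δ ε hPX hXH hHE col hcol Z 𝔭 hcoker
      hloc2 hIG (lengthAt_quotient_ne_top_of_skeleton loc hinj col hcol Z hG hGZ 𝔭 h𝔭)
  · exact lengthAt_eq_of_conj17_6_of_skeleton loc hinj toX δ ε hPX hXH hHE col hcol Z 𝔭 hcoker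
      hloc2 hIG (lengthAt_quotient_span_singleton_ne_top hG 𝔭 h𝔭)

/-- **Conj. 12.10 (at every height-one prime) ⟹ Conj. 17.6 in characteristic-ideal form:
`X` is torsion and `char_R X = (G)`**, over a Noetherian UFD (Kato's `Λ = O_λ⟦G_∞⟧` component by
component, or `ℤ_p⟦T⟧`). Hypotheses as in `conj12_10_iff_conj17_6_of_skeleton` with `H2` torsion
(Thm. 12.4 (1)), the three finiteness inputs and Conj. 12.10 supplied at EVERY height-one prime
(for `𝔭 ∋ p` this is where Kato assumes `p ≠ 2` and (12.5.2)).
[cite: Kato2004Asterisque, Conj. 12.10 (p. 224), Conj. 17.6 (p. 274), §17.13 (p. 280)] -/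
theorem charIdeal_eq_span_of_conj12_10_of_skeleton [IsNoetherianRing R]
    [UniqueFactorizationMonoid R] [Module.Finite R H]
    [Module.IsTorsionFree R H] (hrank : Module.rank R H ≤ 1)
    (loc : H →ₗ[R] P) (toX : P →ₗ[R] X) (δ : X →ₗ[R] H2) (ε : H2 →ₗ[R] H2loc)
    (hPX : Function.Exact loc toX) (hXH : Function.Exact toX δ) (hHE : Function.Exact δ ε)
    (col : P →ₗ[R] R) (hcol : Function.Injective col) (hH2 : Module.IsTorsion R H2)
    (Z : Submodule R H) {G : R} (hG : G ≠ 0) (hGZ : G ∈ Submodule.map (col ∘ₗ loc) Z)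
    (hcoker : ∀ 𝔭 : PrimeSpectrum R, 𝔭.asIdeal.height = 1 →
      lengthAt R (R ⧸ LinearMap.range col) 𝔭 = 0)
    (hloc2 : ∀ 𝔭 : PrimeSpectrum R, 𝔭.asIdeal.height = 1 → lengthAt R H2loc 𝔭 = 0)
    (hIG : ∀ 𝔭 : PrimeSpectrum R, 𝔭.asIdeal.height = 1 →
      lengthAt R (R ⧸ (Z.map loc).map col) 𝔭 = lengthAt R (R ⧸ Ideal.span {G}) 𝔭)
    (hMC : ∀ 𝔭 : PrimeSpectrum R, 𝔭.asIdeal.height = 1 →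
      lengthAt R H2 𝔭 = lengthAt R (H ⧸ Z) 𝔭) :
    Module.IsTorsion R X ∧ charIdeal R X = Ideal.span {G} := by
  obtain ⟨z, -, hz⟩ := Submodule.mem_map.mp hGZ
  simp only [LinearMap.coe_comp, Function.comp_apply] at hz
  refine ⟨isTorsion_of_skeleton loc toX δ hPX hXH col hcol hG hz hH2, ?_⟩
  exact Module.charIdeal_eq_span_of_lengthAt_eq_quotient hG fun 𝔭 h1 =>
    (conj12_10_iff_conj17_6_of_skeleton hrank loc toX δ ε hPX hXH hHE col hcol Z hG hGZ 𝔭 h1.le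
      (hcoker 𝔭 h1) (hloc2 𝔭 h1) (hIG 𝔭 h1)).mp (hMC 𝔭 h1)

end Domain

/-! ### For `X = X(E/ℚ_∞)` over `Λ = ℤ_p⟦T⟧` and `G ↦ L_p(E,T)`: the Mazur / Skinner–Urban shape -/

section Selmer

variable (W : WeierstrassCurve ℚ) [W.IsElliptic] [W.IsGloballyMinimal] (p : ℕ) [Fact p.Prime]
  {κ : ZpExtension ℚ p} {γ : Field.absoluteGaloisGroup ℚ} {N : ℕ} [NeZero N]
  {f : CuspForm (Gamma0 N) 2}
  {H P H2 H2loc : Type*} [AddCommGroup H] [_root_.Module (IwasawaAlgebra p) H]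
  [AddCommGroup P] [_root_.Module (IwasawaAlgebra p) P]
  [AddCommGroup H2] [_root_.Module (IwasawaAlgebra p) H2]
  [AddCommGroup H2loc] [_root_.Module (IwasawaAlgebra p) H2loc]

/-- **Kato Conj. 12.10 for `T ≅ T_pE(-1)` (abstract, at every height-one prime of `Λ = ℤ_p⟦T⟧`)
⟹ Mazur's main conjecture `char_Λ X(E/ℚ_∞) = (L_p(E,T))` — the conclusion of clause 3 of the tree's
`skinner_urban_main_conjecture` (Skinner–Urban 2014 Thm. 3.6.9 = Kato Conj. 17.6 for `T_pE`).**
GIVEN `Λ`-modules `H, P, H2, H2loc` (Kato's `𝐇¹(T(k))`, `𝐇¹_loc(T(k))/𝐇¹_loc(T'(k))`, `𝐇²(T(k))`,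
`𝐇²_loc(T(k))`, `k = 2`) with the §17.13 data towards the Iwasawa module `D.X` of a Pontryagin-dual
datum `D` of `Sel_{p^∞}(E/ℚ_∞)` — (17.13.1)/(17.13.3) exact at `P`, `D.X`, `H2`; `H` f.g. torsion
free of rank `≤ 1` and `H2` torsion (Thm. 12.4); `col : P ↪ Λ` (Prop. 17.11) with `G ∈ col(loc Z)`
and `ι G = L_p(E,T)` (Thm. 16.6 and Thm. 17.4 (3): `L_{p-adic} ∈ Λ`, i.e. the integral situation
`p ≠ 2` + (12.5.2)); at every height-one `𝔭` the three finiteness inputs (17.11, (17.13.4), 16.6)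
— IF Conj. 12.10 holds at every height-one `𝔭` (`ℓ(H2)_𝔭 = ℓ(H/Z)_𝔭`), THEN `D.X` is
`Λ`-torsion and `D.charIdeal = (g)` for a `g ∈ Λ` with `ι g = L_p(E,T)`. `G ≠ 0` is not assumed
(`L_p(E,T) ≠ 0`, Rohrlich: tree theorem `padicLFunction_unitRoot_ne_zero`).
[cite: Kato2004Asterisque, Conj. 12.10 (p. 224), Conj. 17.6 (p. 274), §17.13 (p. 280)]
[cite: SkinnerUrban2014, Thm. 3.6.9 (p. 45)] -/
theorem charIdeal_eq_span_padicLFunction_of_conj12_10_of_skeleton (hord : IsOrdinaryAt W p)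
    (hf : IsNewformOf W f)
    (D : W.SelmerDualData κ γ) [Module.Finite (IwasawaAlgebra p) H]
    [Module.IsTorsionFree (IwasawaAlgebra p) H] (hrank : Module.rank (IwasawaAlgebra p) H ≤ 1)
    (loc : H →ₗ[IwasawaAlgebra p] P) (toX : P →ₗ[IwasawaAlgebra p] D.X)
    (δ : D.X →ₗ[IwasawaAlgebra p] H2) (ε : H2 →ₗ[IwasawaAlgebra p] H2loc)
    (hPX : Function.Exact loc toX) (hXH : Function.Exact toX δ) (hHE : Function.Exact δ ε)
    (col : P →ₗ[IwasawaAlgebra p] IwasawaAlgebra p) (hcol : Function.Injective col)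
    (hH2 : Module.IsTorsion (IwasawaAlgebra p) H2)
    (Z : Submodule (IwasawaAlgebra p) H) {G : IwasawaAlgebra p}
    (hGZ : G ∈ Submodule.map (col ∘ₗ loc) Z)
    (hcoker : ∀ 𝔭 : PrimeSpectrum (IwasawaAlgebra p), 𝔭.asIdeal.height = 1 →
      lengthAt (IwasawaAlgebra p) (IwasawaAlgebra p ⧸ LinearMap.range col) 𝔭 = 0)
    (hloc2 : ∀ 𝔭 : PrimeSpectrum (IwasawaAlgebra p), 𝔭.asIdeal.height = 1 →
      lengthAt (IwasawaAlgebra p) H2loc 𝔭 = 0)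
    (hIG : ∀ 𝔭 : PrimeSpectrum (IwasawaAlgebra p), 𝔭.asIdeal.height = 1 →
      lengthAt (IwasawaAlgebra p) (IwasawaAlgebra p ⧸ (Z.map loc).map col) 𝔭 =
        lengthAt (IwasawaAlgebra p) (IwasawaAlgebra p ⧸ Ideal.span {G}) 𝔭)
    (hιG : iwasawaToPowerSeries p G = padicLFunction f (unitRoot W p : ℚ_[p]))
    (hMC : ∀ 𝔭 : PrimeSpectrum (IwasawaAlgebra p), 𝔭.asIdeal.height = 1 →
      lengthAt (IwasawaAlgebra p) H2 𝔭 = lengthAt (IwasawaAlgebra p) (H ⧸ Z) 𝔭) :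
    D.IsTorsion ∧
      ∃ g : IwasawaAlgebra p,
        iwasawaToPowerSeries p g = padicLFunction f (unitRoot W p : ℚ_[p]) ∧
          D.charIdeal = Ideal.span {g} := by
  have hG : G ≠ 0 := by
    intro hG0
    have hL := padicLFunction_unitRoot_ne_zero hord hf
    rw [hG0, map_zero] at hιG
    exact hL hιG.symm
  obtain ⟨htors, hchar⟩ := charIdeal_eq_span_of_conj12_10_of_skeleton hrank loc toX δ ε hPX hXH
    hHE col hcol hH2 Z hG hGZ hcoker hloc2 hIG hMC
  exact ⟨htors, G, hιG, hchar⟩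

end Selmer

/-! ### Appended (same unit, 2026-08-21): the RATIONAL form — Conj. 17.6, FIRST sentence ("for any
prime ideal `𝔭` of height one of `Λ` which does not contain `p`") in the tree's currency

Kato states Conj. 17.6 in two sentences (p. 274): the equality `length_{Λ_𝔭}(𝔛(T)_𝔭) =
ord_𝔭(L_{p-adic,α,ω,γ}(f))` at the height-one primes NOT containing `p` (no parity, no image
hypothesis; `L_{p-adic} ∈ Λ ⊗ ℚ` only, Thm. 17.4 (2)), and — under `p ≠ 2`, `ω`, `γ` good (and, via
§17.13, (12.5.2)) — at every height-one prime. The tree's currency for the first sentence is the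
shape of clause 2 of `skinner_urban_main_conjecture` / of `kato_divisibility` (2):
"`char_Λ X = (g)` with `ι g = p^k · L_p(E,T)` for some `k ∈ ℤ`" (the units of `Λ[1/p]` are
`p^ℤ · Λˣ`). The passage from the prime-by-prime equalities at `𝔭 ∌ p` to that shape is pure
`Λ`-algebra and is proved here: `Kato2004.exists_charIdeal_eq_span_of_lengthAt_eq_off_p` (generic:
a f.g. torsion `Λ`-module whose local lengths agree with those of `Λ/(G)` at every height-one
`𝔭 ≠ (p)` has `char_Λ X = (g)` with `p^b · g = u · p^a · G`, `u ∈ Λˣ`, `a = μ(X)`, `b = ord_p G`),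
and `Kato2004.exists_charIdeal_eq_span_pow_padicLFunction_of_conj12_10_of_skeleton` (the §17.13
data with `ι G = p^n · L_p(E,T)` and Conj. 12.10 at every height-one `𝔭 ∌ p` ⟹ `D.X` torsion and
`D.charIdeal = (g)`, `ι g = p^k · L_p(E,T)`, `k ∈ ℤ`).
[cite: Kato2004Asterisque, Conj. 17.6 (p. 274), Thm. 17.4 (2) (p. 273), §17.13 (p. 280)] -/

section Rational

open IwasawaAlgebra

variable (p : ℕ) [Fact p.Prime]

/-- **From "`ℓ(X)_𝔭 = ℓ(Λ/(G))_𝔭` at every height-one `𝔭 ∌ p`" to the characteristic ideal, up to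
a power of `p`.** For a finitely generated torsion `Λ = ℤ_p⟦T⟧`-module `X` and `G ≠ 0`: if the local
lengths of `X` and `Λ/(G)` agree at every height-one prime other than `(p)`, then
`char_Λ X = (g)` for a `g` with `p^b · g` ASSOCIATED to `p^a · G`, where `a = ℓ(X)_{(p)}` (the
`μ`-invariant of `X`) and `b = ℓ(Λ/(G))_{(p)} = ord_p G`. (Compare `X ⊕ Λ/(p^b)` with
`Λ/(p^a G)`: their local lengths agree at EVERY height-one prime, so by
`Module.charIdeal_eq_span_of_lengthAt_eq_quotient` and the multiplicativity of `char` in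
`0 → X → X ⊕ Λ/(p^b) → Λ/(p^b) → 0`, `char X · (p^b) = (p^a G)`; `char X` is principal since `Λ` is
a UFD.) This is the `Λ`-algebra behind reading Kato's Conj. 17.6, first sentence / Thm. 17.4 (2)
("for any prime ideal `𝔭` of height one which does not contain `p`") as an identity of principal
ideals of `Λ ⊗ ℚ = Λ[1/p]`, whose units are `p^ℤ · Λˣ`.
[cite: Kato2004Asterisque, Conj. 17.6 (p. 274) and Thm. 17.4 (2) (p. 273)]
[cite: Washington1997, §13.2] -/
theorem exists_charIdeal_eq_span_of_lengthAt_eq_off_p {X : Type*} [AddCommGroup X]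
    [_root_.Module (IwasawaAlgebra p) X] [Module.Finite (IwasawaAlgebra p) X]
    (hX : Module.IsTorsion (IwasawaAlgebra p) X) {G : IwasawaAlgebra p} (hG : G ≠ 0)
    (h : ∀ 𝔭 : PrimeSpectrum (IwasawaAlgebra p), 𝔭.asIdeal.height = 1 →
      PowerSeries.C (p : ℤ_[p]) ∉ 𝔭.asIdeal →
        lengthAt (IwasawaAlgebra p) X 𝔭 =
          lengthAt (IwasawaAlgebra p) (IwasawaAlgebra p ⧸ Ideal.span {G}) 𝔭) :
    ∃ (g : IwasawaAlgebra p) (a b : ℕ),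
      charIdeal (IwasawaAlgebra p) X = Ideal.span {g} ∧
        Associated (PowerSeries.C (p : ℤ_[p]) ^ b * g) (PowerSeries.C (p : ℤ_[p]) ^ a * G) := by
  classical
  set π : IwasawaAlgebra p := PowerSeries.C (p : ℤ_[p]) with hπdef
  have hπ : Prime π := prime_C p
  haveI : (augIdealP p).IsPrime := isPrime_augIdealP_holds p
  let 𝔭₀ : PrimeSpectrum (IwasawaAlgebra p) := ⟨augIdealP p, inferInstance⟩
  have h𝔭₀ : 𝔭₀.asIdeal = augIdealP p := rfl
  have h𝔭₀1 : 𝔭₀.asIdeal.height = 1 := height_augIdealP_holds p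
  -- the two exponents at `(p)`
  have haX : lengthAt (IwasawaAlgebra p) X 𝔭₀ ≠ ⊤ := lengthAt_ne_top_of_isTorsion p X hX 𝔭₀ h𝔭₀
  have hbG : lengthAt (IwasawaAlgebra p) (IwasawaAlgebra p ⧸ Ideal.span {G}) 𝔭₀ ≠ ⊤ :=
    lengthAt_ne_top_of_isTorsionBy hG (Module.isTorsionBy_quotient_span_singleton G) 𝔭₀
      h𝔭₀1.le
  obtain ⟨a, ha⟩ : ∃ a : ℕ, (a : ℕ∞) = lengthAt (IwasawaAlgebra p) X 𝔭₀ :=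
    ⟨_, ENat.coe_toNat haX⟩
  obtain ⟨b, hb⟩ : ∃ b : ℕ,
      (b : ℕ∞) = lengthAt (IwasawaAlgebra p) (IwasawaAlgebra p ⧸ Ideal.span {G}) 𝔭₀ :=
    ⟨_, ENat.coe_toNat hbG⟩
  -- `X ⊕ Λ/(p^b)` versus `Λ/(p^a G)`: equal local lengths at every height-one prime
  set Q := IwasawaAlgebra p ⧸ Ideal.span {π ^ b}
  have hπa : π ^ a ≠ 0 := pow_ne_zero a hπ.ne_zero
  have hπb : π ^ b ≠ 0 := pow_ne_zero b hπ.ne_zero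
  have hlen : ∀ 𝔭 : PrimeSpectrum (IwasawaAlgebra p), 𝔭.asIdeal.height = 1 →
      lengthAt (IwasawaAlgebra p) (X × Q) 𝔭 =
        lengthAt (IwasawaAlgebra p) (IwasawaAlgebra p ⧸ Ideal.span {π ^ a * G}) 𝔭 := by
    intro 𝔭 h1
    rw [lengthAt_prod, lengthAt_quotient_span_singleton_mul G hπa 𝔭,
      lengthAt_quotient_span_singleton_pow hπ.ne_zero b 𝔭,
      lengthAt_quotient_span_singleton_pow hπ.ne_zero a 𝔭,
      lengthAt_quotient_span_singleton hπ 𝔭 h1]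
    by_cases hmem : π ∈ 𝔭.asIdeal
    · -- then `𝔭 = (p) = 𝔭₀`
      have h𝔭eq : 𝔭 = 𝔭₀ :=
        PrimeSpectrum.ext ((Ideal.eq_span_singleton_of_height_eq_one h1 hmem hπ).trans h𝔭₀.symm)
      rw [if_pos hmem, h𝔭eq, ← ha, ← hb, nsmul_one, nsmul_one, add_comm]
    · rw [if_neg hmem, h 𝔭 h1 hmem, nsmul_zero, nsmul_zero, add_zero, zero_add]
  -- hence `char(X ⊕ (IwasawaAlgebra p)/(p^b)) = (p^a G)`
  have hM : charIdeal (IwasawaAlgebra p) (X × Q) = Ideal.span {π ^ a * G} :=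
    Module.charIdeal_eq_span_of_lengthAt_eq_quotient (mul_ne_zero hπa hG) hlen
  -- multiplicativity along `0 → X → X × Q → Q → 0`
  have hQt : Module.IsTorsion (IwasawaAlgebra p) Q := fun q =>
    ⟨⟨π ^ b, mem_nonZeroDivisors_of_ne_zero hπb⟩,
      Module.isTorsionBy_quotient_span_singleton (π ^ b) (x := q)⟩
  have hexact : Function.Exact (LinearMap.inl (IwasawaAlgebra p) X Q)
      (LinearMap.snd (IwasawaAlgebra p) X Q) := by
    intro y
    constructor
    · intro hy
      have hy' : y.2 = 0 := hy
      exact ⟨y.1, Prod.ext rfl hy'.symm⟩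
    · rintro ⟨x, rfl⟩
      rfl
  have hXQt : Module.IsTorsion (IwasawaAlgebra p) (X × Q) :=
    isTorsion_of_exact (LinearMap.inl (IwasawaAlgebra p) X Q) (LinearMap.snd (IwasawaAlgebra p) X Q)
      hexact hX hQt
  have hmul : charIdeal (IwasawaAlgebra p) (X × Q) =
      charIdeal (IwasawaAlgebra p) X * charIdeal (IwasawaAlgebra p) Q :=
    charIdeal_eq_mul_of_exact hXQt (LinearMap.inl (IwasawaAlgebra p) X Q)
      (LinearMap.snd (IwasawaAlgebra p) X Q) LinearMap.inl_injective LinearMap.snd_surjective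
      hexact
  have hQ : charIdeal (IwasawaAlgebra p) Q = Ideal.span {π ^ b} :=
    Module.charIdeal_eq_span_of_lengthAt_eq_quotient hπb fun _ _ => rfl
  -- `char X` is principal
  have hP : (charIdeal (IwasawaAlgebra p) X).IsPrincipal := charIdeal_isPrincipal_holds p X
  obtain ⟨g, hg⟩ := hP
  have hg' : charIdeal (IwasawaAlgebra p) X = Ideal.span {g} := by rw [hg, Ideal.submodule_span_eq]
  rw [hmul, hQ, hg', Ideal.span_singleton_mul_span_singleton] at hM
  refine ⟨g, a, b, hg', ?_⟩
  rw [mul_comm (π ^ b) g]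
  exact Ideal.span_singleton_eq_span_singleton.mp hM

variable (W : WeierstrassCurve ℚ) [W.IsElliptic] [W.IsGloballyMinimal]
  {κ : ZpExtension ℚ p} {γ : Field.absoluteGaloisGroup ℚ} {N : ℕ} [NeZero N]
  {f : CuspForm (Gamma0 N) 2}
  {H P H2 H2loc : Type*} [AddCommGroup H] [_root_.Module (IwasawaAlgebra p) H]
  [AddCommGroup P] [_root_.Module (IwasawaAlgebra p) P]
  [AddCommGroup H2] [_root_.Module (IwasawaAlgebra p) H2]
  [AddCommGroup H2loc] [_root_.Module (IwasawaAlgebra p) H2loc]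

/-- **Kato Conj. 12.10 at the height-one primes `𝔭 ∌ p` (abstract) ⟹ Conj. 17.6, first sentence, for
`T_pE` in the tree's currency: `char_Λ X(E/ℚ_∞) = (g)` with `ι g = p^k · L_p(E,T)`, `k ∈ ℤ`** —
the conclusion-shape of clause 2 of `skinner_urban_main_conjecture` / `kato_divisibility` (2) with
"=" for "∣". GIVEN the §17.13 data towards `D.X` as in
`charIdeal_eq_span_padicLFunction_of_conj12_10_of_skeleton`, but with `ι G = p^n · L_p(E,T)` only
(Thm. 17.4 (2): `L_{p-adic} ∈ Λ ⊗ ℚ`; no parity or image hypothesis) and the three finiteness inputs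
and Conj. 12.10 supplied only at the height-one primes NOT containing `p` (Kato: "In the case `𝔭`
contains `p`, we assume `p ≠ 2` and … (12.5.2)" — not assumed here): THEN `D.X` is `Λ`-torsion
and `D.charIdeal = (g)` with `ι g = p^k · L_p(E,T)` for some `g ∈ Λ`, `k ∈ ℤ`.
[cite: Kato2004Asterisque, Conj. 12.10 (p. 224), Conj. 17.6 (p. 274), Thm. 17.4 (2), §17.13]
[cite: SkinnerUrban2014, Thm. 3.6.9 (p. 45)] -/
theorem exists_charIdeal_eq_span_pow_padicLFunction_of_conj12_10_of_skeleton
    (hord : IsOrdinaryAt W p) (hf : IsNewformOf W f) (hκ : κ.IsCyclotomic)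
    (hγ : κ.IsTopGenerator γ) (D : W.SelmerDualData κ γ) [Module.Finite (IwasawaAlgebra p) H]
    [Module.IsTorsionFree (IwasawaAlgebra p) H] (hrank : Module.rank (IwasawaAlgebra p) H ≤ 1)
    (loc : H →ₗ[IwasawaAlgebra p] P) (toX : P →ₗ[IwasawaAlgebra p] D.X)
    (δ : D.X →ₗ[IwasawaAlgebra p] H2) (ε : H2 →ₗ[IwasawaAlgebra p] H2loc)
    (hPX : Function.Exact loc toX) (hXH : Function.Exact toX δ) (hHE : Function.Exact δ ε)
    (col : P →ₗ[IwasawaAlgebra p] IwasawaAlgebra p) (hcol : Function.Injective col)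
    (hH2 : Module.IsTorsion (IwasawaAlgebra p) H2)
    (Z : Submodule (IwasawaAlgebra p) H) {G : IwasawaAlgebra p}
    (hGZ : G ∈ Submodule.map (col ∘ₗ loc) Z)
    (hcoker : ∀ 𝔭 : PrimeSpectrum (IwasawaAlgebra p), 𝔭.asIdeal.height = 1 →
      PowerSeries.C (p : ℤ_[p]) ∉ 𝔭.asIdeal →
        lengthAt (IwasawaAlgebra p) (IwasawaAlgebra p ⧸ LinearMap.range col) 𝔭 = 0)
    (hloc2 : ∀ 𝔭 : PrimeSpectrum (IwasawaAlgebra p), 𝔭.asIdeal.height = 1 →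
      PowerSeries.C (p : ℤ_[p]) ∉ 𝔭.asIdeal → lengthAt (IwasawaAlgebra p) H2loc 𝔭 = 0)
    (hIG : ∀ 𝔭 : PrimeSpectrum (IwasawaAlgebra p), 𝔭.asIdeal.height = 1 →
      PowerSeries.C (p : ℤ_[p]) ∉ 𝔭.asIdeal →
        lengthAt (IwasawaAlgebra p) (IwasawaAlgebra p ⧸ (Z.map loc).map col) 𝔭 =
          lengthAt (IwasawaAlgebra p) (IwasawaAlgebra p ⧸ Ideal.span {G}) 𝔭)
    {n : ℕ} (hιG : iwasawaToPowerSeries p G =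
      PowerSeries.C ((p : ℚ_[p]) ^ n) * padicLFunction f (unitRoot W p : ℚ_[p]))
    (hMC : ∀ 𝔭 : PrimeSpectrum (IwasawaAlgebra p), 𝔭.asIdeal.height = 1 →
      PowerSeries.C (p : ℤ_[p]) ∉ 𝔭.asIdeal →
        lengthAt (IwasawaAlgebra p) H2 𝔭 = lengthAt (IwasawaAlgebra p) (H ⧸ Z) 𝔭) :
    D.IsTorsion ∧
      ∃ (g : IwasawaAlgebra p) (k : ℤ), D.charIdeal = Ideal.span {g} ∧
        iwasawaToPowerSeries p g =
          PowerSeries.C ((p : ℚ_[p]) ^ k) * padicLFunction f (unitRoot W p : ℚ_[p]) := by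
  set L := padicLFunction f (unitRoot W p : ℚ_[p]) with hLdef
  haveI : Module.Finite (IwasawaAlgebra p) D.X := D.module_finite_of_isCyclotomic W κ hκ hγ
  have hp0 : (p : ℚ_[p]) ≠ 0 := Nat.cast_ne_zero.mpr (Fact.out : p.Prime).ne_zero
  have hG : G ≠ 0 := by
    intro hG0
    have hL0 : L ≠ 0 := padicLFunction_unitRoot_ne_zero hord hf
    have hpn : PowerSeries.C ((p : ℚ_[p]) ^ n) ≠ 0 := by
      rw [Ne, map_eq_zero_iff _ (PowerSeries.C_injective)]
      exact pow_ne_zero _ hp0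
    rw [hG0, map_zero, eq_comm, mul_eq_zero] at hιG
    exact hιG.elim hpn hL0
  obtain ⟨z, -, hz⟩ := Submodule.mem_map.mp hGZ
  simp only [LinearMap.coe_comp, Function.comp_apply] at hz
  have htors : Module.IsTorsion (IwasawaAlgebra p) D.X :=
    isTorsion_of_skeleton loc toX δ hPX hXH col hcol hG hz hH2
  have hlen : ∀ 𝔭 : PrimeSpectrum (IwasawaAlgebra p), 𝔭.asIdeal.height = 1 →
      PowerSeries.C (p : ℤ_[p]) ∉ 𝔭.asIdeal →
        lengthAt (IwasawaAlgebra p) D.X 𝔭 =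
          lengthAt (IwasawaAlgebra p) (IwasawaAlgebra p ⧸ Ideal.span {G}) 𝔭 :=
    fun 𝔭 h1 hp𝔭 => (conj12_10_iff_conj17_6_of_skeleton hrank loc toX δ ε hPX hXH hHE col hcol Z
      hG hGZ 𝔭 h1.le (hcoker 𝔭 h1 hp𝔭) (hloc2 𝔭 h1 hp𝔭) (hIG 𝔭 h1 hp𝔭)).mp (hMC 𝔭 h1 hp𝔭)
  obtain ⟨g, a, b, hchar, u, hu⟩ :=
    exists_charIdeal_eq_span_of_lengthAt_eq_off_p p htors hG hlen
  -- `g' = g·u` generates the same ideal and satisfies `p^b · g' = p^a · G`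
  obtain ⟨g', hg'def⟩ : ∃ g' : IwasawaAlgebra p, g' = g * ↑u := ⟨_, rfl⟩
  have hrel : PowerSeries.C (p : ℤ_[p]) ^ b * g' = PowerSeries.C (p : ℤ_[p]) ^ a * G := by
    rw [hg'def, ← mul_assoc]
    exact hu
  refine ⟨htors, g', (a : ℤ) + n - b, ?_, ?_⟩
  · rw [show D.charIdeal = charIdeal (IwasawaAlgebra p) D.X from rfl, hchar, hg'def]
    exact (Ideal.span_singleton_mul_right_unit u.isUnit g).symm
  · -- apply `ι` to `p^b · g' = p^a · G` and divide by `p^b` in `ℚ_p⟦T⟧`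
    have hιG' : iwasawaToPowerSeries p G = PowerSeries.C (p : ℚ_[p]) ^ n * L := by
      rw [hιG, map_pow]
    have hι := congrArg (iwasawaToPowerSeries p) hrel
    rw [map_mul, map_mul, map_pow, map_pow, hιG', PowerSeries.map_C, map_natCast, ← mul_assoc,
      ← pow_add] at hι
    -- `hι : C p ^ b * ι g' = C p ^ (a + n) * L`
    have hexp : ((p : ℚ_[p]) ^ b)⁻¹ * (p : ℚ_[p]) ^ (a + n) = (p : ℚ_[p]) ^ ((a : ℤ) + n - b) := by
      rw [← zpow_natCast, ← zpow_natCast, ← zpow_neg, ← zpow_add₀ hp0]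
      congr 1
      push_cast
      ring
    calc iwasawaToPowerSeries p g'
        = PowerSeries.C (((p : ℚ_[p]) ^ b)⁻¹) *
            (PowerSeries.C (p : ℚ_[p]) ^ b * iwasawaToPowerSeries p g') := by
          rw [← map_pow, ← mul_assoc, ← map_mul, inv_mul_cancel₀ (pow_ne_zero _ hp0), map_one,
            one_mul]
      _ = PowerSeries.C (((p : ℚ_[p]) ^ b)⁻¹) * (PowerSeries.C (p : ℚ_[p]) ^ (a + n) * L) := by
          rw [hι]
      _ = PowerSeries.C ((p : ℚ_[p]) ^ ((a : ℤ) + n - b)) * L := by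
          rw [← map_pow, ← mul_assoc, ← map_mul, hexp]

end Rational

end Kato2004

end Literature.NumberTheory.EllipticCurves

end
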